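import Mathlib.Analysis.SpecialFunctions.Pow.Real
import Literature.Geometry.DiscreteGeometry.TriangularLatticeRows
import HarnessLib

/-!
# Sharp supported-triangle excess in the triangular label lattice (helper toward `StackingLiminf`,
# stmt-Ventures-19145)

Cell `crystal3d-full`, venture `Summits/Ventures/Crystal3D`.  Sharpening of
`StickyWulffConstantStackingLiminfSupportedExcess.lean` (`t ≤ |S| − √|S|`): for a finite label
set `S ⊂ ℤ²` and a sign `s = ±1`, the number `t` of sites `w ∈ S` with `w + (s,0) ∈ S` and
`w + (0,s) ∈ S` satisfies `t + m ≤ |S|` for some `m` with `m(m+1) ≥ 2|S|`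
(`exists_card_supported_add_le`), hence `t ≤ |S| + 1/2 − √(2|S|)` — SHARP (lattice triangles:
`|S| = m(m+1)/2`, `t = |S| − m`).  This is the input for pushing the word-uniform surface rung
from `∛320` towards `≈ 7.3` (coefficient `√2` instead of `1` in the supported-triangle bound).

Proof (rows + a descent budget): with row sizes `r(y)`, `t ≤ ∑_y min(r(y) − 1, r(y+s))
= |S| − h − D` where `h` = #rows and `D = ∑_y (r(y) − 1 − r(y+s))₊`; and
`r(y) ≤ #{rows at or after y} + D`, so `|S| ≤ h(h+1)/2 + hD ≤ (h+D)(h+D+1)/2`.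

WHAT THIS IS NOT: anything about packings by itself; pure counting on `ℤ²`.
-/

noncomputable section

namespace Summit.Ventures.Crystal3D.Theorems

open Finset
open Literature.Geometry.DiscreteGeometry.HarborthSpiral (row mem_row card_row
  card_filter_succ_mem_add_one_le card_filter_pred_mem_add_one_le)

/-- In a finite row, the sites with a neighbour in direction `s = ±1` are all but at least one. -/
theorem card_filter_add_mem_add_one_le (R : Finset ℤ) (hR : R.Nonempty) {s : ℤ}
    (hs : s = 1 ∨ s = -1) : (R.filter fun m => m + s ∈ R).card + 1 ≤ R.card := by
  rcases hs with rfl | rfl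
  · exact card_filter_succ_mem_add_one_le R hR
  · have e : (R.filter fun m => m + -1 ∈ R) = R.filter fun m => m - 1 ∈ R :=
      filter_congr fun m _ => by rw [← sub_eq_add_neg]
    rw [e]; exact card_filter_pred_mem_add_one_le R hR

/-- The number of ordered pairs `(y, y')` of a finite `R ⊂ ℤ` with `s·y ≤ s·y'` (`s ≠ 0`) is
`h(h+1)/2`, `h = |R|`: `2·∑_y #{y' : s y ≤ s y'} = h² + h`. -/
theorem two_mul_sum_card_filter_eq (R : Finset ℤ) {s : ℤ} (hs : s ≠ 0) :
    2 * ∑ y ∈ R, (R.filter fun y' => s * y ≤ s * y').card = R.card ^ 2 + R.card := by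
  induction R using Finset.induction_on_max_value (f := fun y => s * y) with
  | empty => simp
  | insert a R haR hmax ih =>
    rw [sum_insert haR, card_insert_of_notMem haR]
    have hTa : ((insert a R).filter fun y' => s * a ≤ s * y') = {a} := by
      ext y'
      simp only [mem_filter, mem_insert, mem_singleton]
      constructor
      · rintro ⟨h | h, hle⟩
        · exact h
        · have h' := hmax y' h
          have : s * y' = s * a := le_antisymm h' hle
          exact mul_left_cancel₀ hs this
      · rintro rfl; exact ⟨Or.inl rfl, le_rfl⟩
    have hTy : ∀ y ∈ R, ((insert a R).filter fun y' => s * y ≤ s * y') =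
        insert a (R.filter fun y' => s * y ≤ s * y') := by
      intro y hy
      rw [filter_insert, if_pos (hmax y hy)]
    have hsum : ∑ y ∈ R, ((insert a R).filter fun y' => s * y ≤ s * y').card =
        ∑ y ∈ R, ((R.filter fun y' => s * y ≤ s * y').card + 1) := by
      refine sum_congr rfl fun y hy => ?_
      rw [hTy y hy, card_insert_of_notMem fun h => haR (mem_filter.1 h).1]
    rw [hTa, card_singleton, hsum, sum_add_distrib, sum_const, smul_eq_mul, mul_one]
    nlinarith [ih]

/-- **Sharp supported-triangle excess.** For `s = ±1` there is `m` with
`#{w ∈ S : w + (s,0) ∈ S ∧ w + (0,s) ∈ S} + m ≤ |S|` and `2|S| ≤ m(m+1)`. -/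
theorem exists_card_supported_add_le (S : Finset (ℤ × ℤ)) {s : ℤ} (hs : s = 1 ∨ s = -1) :
    ∃ m : ℕ, (S.filter fun q => (q.1 + s, q.2) ∈ S ∧ (q.1, q.2 + s) ∈ S).card + m ≤ S.card ∧
      2 * S.card ≤ m * (m + 1) := by
  classical
  have hs0 : s ≠ 0 := by omega
  have hs2 : s * s = 1 := by rcases hs with rfl | rfl <;> norm_num
  set R := S.image Prod.snd with hR
  set r : ℤ → ℕ := fun y => (S.filter fun q => q.2 = y).card with hr
  have hr_zero : ∀ y, y ∉ R → r y = 0 := by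
    intro y hy
    refine card_eq_zero.2 (filter_eq_empty_iff.2 fun q hq hqy => hy ?_)
    exact hqy ▸ mem_image_of_mem _ hq
  have hcardS : S.card = ∑ y ∈ R, r y :=
    card_eq_sum_card_fiberwise (f := Prod.snd) (s := S) (t := R) fun q hq => mem_image_of_mem _ hq
  -- per-row bounds on the supported sites
  set T := S.filter fun q => (q.1 + s, q.2) ∈ S ∧ (q.1, q.2 + s) ∈ S with hT
  have hTsum : T.card = ∑ y ∈ R, (T.filter fun q => q.2 = y).card :=
    card_eq_sum_card_fiberwise (f := Prod.snd) (s := T) (t := R)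
      fun q hq => mem_image_of_mem _ (mem_filter.1 hq).1
  have hrow1 : ∀ y ∈ R, (T.filter fun q => q.2 = y).card + 1 ≤ r y := by
    intro y hy
    have hne : (row S y).Nonempty :=
      Literature.Geometry.DiscreteGeometry.HarborthSpiral.row_nonempty_iff.2 hy
    have h1 := card_filter_add_mem_add_one_le (row S y) hne hs
    rw [card_row] at h1
    refine le_trans (Nat.add_le_add_right (card_le_card_of_injOn Prod.fst (fun q hq => ?_) ?_) 1) h1
    · obtain ⟨hqT, hqy⟩ := mem_filter.1 (mem_coe.1 hq)
      obtain ⟨hqS, h1', -⟩ := mem_filter.1 hqT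
      rw [mem_coe, mem_filter, mem_row, mem_row, ← hqy]
      exact ⟨hqS, h1'⟩
    · intro q hq q' hq' h
      exact Prod.ext h ((mem_filter.1 (mem_coe.1 hq)).2.trans (mem_filter.1 (mem_coe.1 hq')).2.symm)
  have hrow2 : ∀ y ∈ R, (T.filter fun q => q.2 = y).card ≤ r (y + s) := by
    intro y hy
    refine card_le_card_of_injOn (fun q => (q.1, q.2 + s)) (fun q hq => ?_) ?_
    · obtain ⟨hqT, hqy⟩ := mem_filter.1 (mem_coe.1 hq)
      obtain ⟨-, -, h2'⟩ := mem_filter.1 hqT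
      rw [mem_coe, mem_filter]
      exact ⟨h2', by rw [← hqy]⟩
    · intro q hq q' hq' h
      simp only [Prod.mk.injEq] at h
      exact Prod.ext h.1 (by omega)
  -- descent budget
  set δ : ℤ → ℕ := fun y => r y - 1 - r (y + s) with hδ
  set D := ∑ y ∈ R, δ y with hD
  have hmin : ∀ y ∈ R, (T.filter fun q => q.2 = y).card + 1 + δ y ≤ r y := by
    intro y hy
    have h1 := hrow1 y hy
    have h2 := hrow2 y hy
    simp only [hδ]; omega
  have ht : T.card + R.card + D ≤ S.card := by
    rw [hTsum, hcardS, hD, card_eq_sum_ones R, ← sum_add_distrib, ← sum_add_distrib]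
    exact sum_le_sum fun y hy => hmin y hy
  have hdesc : ∀ y ∈ R, r y ≤ (R.filter fun y' => s * y ≤ s * y').card + D := by
    intro y hy
    set Ty := R.filter fun y' => s * y ≤ s * y' with hTy
    have hyTy : y ∈ Ty := mem_filter.2 ⟨hy, le_rfl⟩
    have hshift : ∑ y' ∈ Ty, r (y' + s) ≤ ∑ z ∈ Ty.erase y, r z := by
      rw [← sum_image (f := r) (s := Ty) (g := fun y' => y' + s)
        (fun a _ b _ h => add_right_cancel h)]
      rw [← sum_filter_add_sum_filter_not (Ty.image fun y' => y' + s) (· ∈ R)]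
      have hz : ∑ z ∈ (Ty.image fun y' => y' + s).filter (fun z => ¬ z ∈ R), r z = 0 :=
        sum_eq_zero fun z hz => hr_zero z (mem_filter.1 hz).2
      rw [hz, add_zero]
      refine sum_le_sum_of_subset_of_nonneg (fun z hz => ?_) fun _ _ _ => Nat.zero_le _
      obtain ⟨hzimg, hzR⟩ := mem_filter.1 hz
      obtain ⟨y', hy', rfl⟩ := mem_image.1 hzimg
      have hy'le := (mem_filter.1 hy').2
      have e : s * (y' + s) = s * y' + 1 := by rw [mul_add, hs2]
      rw [mem_erase, hTy, mem_filter]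
      exact ⟨fun h => by rw [h] at e; linarith, hzR, by linarith⟩
    have hsumTy : ∑ y' ∈ Ty, r y' ≤ Ty.card + ∑ y' ∈ Ty, δ y' + ∑ y' ∈ Ty, r (y' + s) := by
      rw [card_eq_sum_ones, ← sum_add_distrib, ← sum_add_distrib]
      exact sum_le_sum fun y' _ => by simp only [hδ]; omega
    have hδsub : ∑ y' ∈ Ty, δ y' ≤ D :=
      sum_le_sum_of_subset_of_nonneg (filter_subset _ _) fun _ _ _ => Nat.zero_le _
    have herase : ∑ z ∈ Ty.erase y, r z + r y = ∑ z ∈ Ty, r z := sum_erase_add _ _ hyTy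
    omega
  -- total: `2|S| ≤ h² + h + 2hD`
  have hpairs := two_mul_sum_card_filter_eq R hs0
  have hv : 2 * S.card ≤ R.card ^ 2 + R.card + 2 * (R.card * D) := by
    have h := sum_le_sum hdesc
    rw [sum_add_distrib, sum_const, smul_eq_mul, ← hcardS] at h
    nlinarith [h, hpairs]
  exact ⟨R.card + D, by omega, by nlinarith [hv]⟩

/-- Real form of the sharp excess: `#supported ≤ |S| + 1/2 − √(2|S|)`. -/
theorem card_supported_le_sub_sqrt_two (S : Finset (ℤ × ℤ)) {s : ℤ} (hs : s = 1 ∨ s = -1) :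
    ((S.filter fun q => (q.1 + s, q.2) ∈ S ∧ (q.1, q.2 + s) ∈ S).card : ℝ) ≤
      (S.card : ℝ) + 1 / 2 - Real.sqrt (2 * S.card) := by
  obtain ⟨m, h1, h2⟩ := exists_card_supported_add_le S hs
  have h1r : ((S.filter fun q => (q.1 + s, q.2) ∈ S ∧ (q.1, q.2 + s) ∈ S).card : ℝ) + m ≤
      S.card := by exact_mod_cast h1
  have h2r : 2 * (S.card : ℝ) ≤ m * (m + 1) := by exact_mod_cast h2
  have h3 : Real.sqrt (2 * S.card) ≤ m + 1 / 2 := by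
    have h := Real.sqrt_le_sqrt (show 2 * (S.card : ℝ) ≤ (m + 1 / 2) ^ 2 by nlinarith)
    rwa [Real.sqrt_sq (by positivity)] at h
  linarith

end Summit.Ventures.Crystal3D.Theorems

end
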